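import Summits.BirchSwinnertonDyer.BirchSwinnertonDyer.Theorems.AdditiveBranchIMCGordTwoRankOneVisibilityBookingRecords
import Literature.NumberTheory.EllipticCurves.Fisher2012.HesseFamilyThreeCongruenceProofs
import Literature.NumberTheory.EllipticCurves.Fisher2012.HesseFamilyThreeReverseProofs
import HarnessLib

/-!
# Crux `GordTwoRankOne` (item 19358): the four CONTENT-window visibility records with the `3`-CONGRUENCE PROVED IN THE KERNEL —
# `ord₃ #Ш(E)_an ≤ ord₃ #Ш(E)` and `BSD(E,3)` BY NAME for `E ∈ {205623g1, 355392y1, 417024bc1, 449352f1}`, binder `θ` of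
# `…VisibilityRecord<E>` / `…VisibilityBookingRecords` DISCHARGED by Fisher's Hesse-pencil certificates (tree theorems, no named fact)

Cell `bsd-addord`, seat `bsd-addord-k1-c3` (D-0074 row B2), gen 8; `--supports stmt-BirchSwinnertonDyer-19358 --as helper`. Planner g18 road (α)
(STATUS 2026-08-27T02:22:40Z): a `_of_congr` record whose `θ : F[3] ⥲ E[3]` is displayed and evidenced only by an `a_ℓ`-screen is not bookable
(referee A R400.3); here `θ` is CONSTRUCTED: the partner `F` is a rational point of the direct Hesse pencil `X_E(3)` (three keys) or of the dual
pencil `X_E⁻(3)` (`449352f1`), certificate `((λ:μ), u)` checked by `norm_num` on the tree's closed forms `eval_hesseC4three` /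
`eval_hesseC6three` / `eval_hesseD3` (`Fisher2012/HesseFamilyThreeReverse.lean`) and transported by the PROVED theorems
`Fisher2012.threeCongruent_of_hesseCertificate_unconditional` (`HesseFamilyThreeCongruenceProofs.lean`, Fisher 2012 Thm. 13.2, `n = 3`)
/ `Fisher2012.threeCongruent_of_dualHesseCertificate_unconditional` (`HesseFamilyThreeReverseProofs.lean`, §13). The partner's
ellipticity / minimality instances are the record files' `isElliptic_c<F>` / `isGloballyMinimal_c<F>` (Kraus, kernel). HONEST FRAMING:
nothing here proves the Birch–Swinnerton-Dyer conjecture or the crux (OPEN at class level on 19497/19498/19499); THEOREMS ONLY; per pair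
(an OFFER shape for referee A: T-BX4G-r1 @3 grammar + `hCT`, marker `congr3:kernel-Hesse(proved)`); NOT a class theorem; nothing booked by this file.

## What (per key `E`, partner `F`)

* `threeCongruent_c<E>_c<F>` — `∃ θ : F[3] ≃+ E[3]` `Γ_ℚ`-equivariant, from `hWeq` alone (certificate in the docstring).
* `missingLowerBoundAt_c<E>_3` — the crux's conclusion AT THE PAIR, `MissingLowerBoundAt W 3` (`ord₃ #Ш(E)_an ≤ ord₃ #Ш(E)`), from the cite-only
  `hCT hGZK`, the model `hWeq`, Cremona's `r_an = 1` (`hr1`) and the EXACT datum `#Ш(E)_an = q`, `ord₃ q ≤ 2` (`hq`/`hv`; Cremona `#Ш_an = 9`) —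
  NO partner binder, NO `θ`: everything else in the kernel (record `missingLowerBoundAt_c<E>_3_of_congr`).
* `bsdp_c<E>_3` — `BSD(E,3)` from the cite-only `hK hCT hCyc hArt h73 hWald hmod hmodD hmodN hGZK`, the model `hWeq`, the data-level flags
  `ClassX4Gord W 3`, `Surj W 3`, `r_an = 1`, the two-engine weak certificate `BranchCoeffOneNeZeroAt W 3` (`A′(E,3) ≠ 0`, k1-c3 g7
  `vis12-g7/aprime/APRIME-p3-4keys.tsv`, engines gz5-p3 byte-identical) and `hq`/`hv` (door `bsdp_c<E>_3_of_congr`).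

Certificates (k1-c3 g8 `work/hesse3/find_hesse3.py`, exact rational arithmetic; re-verified by the kernel below):
`205623g1 ← 159929a1` direct `(−492 : 1)`, `u = 108`; `355392y1 ← 355392a1` direct `(−2808 : 1)`, `u = 3072`; `417024bc1 ← 46336j1` direct
`(−114936 : 7)`, `u = 216`; `449352f1 ← 449352b1` dual `(6636 : 1)`, `u = 1/1896`.

References: [Fisher2012Hessian] T. Fisher, The Hessian of a genus one curve, Proc. LMS (3) 104 (2012) 613–648, §8, §13, Thm. 13.2;
[CremonaMazur2000] §3; [AgasheStein2002] Lemma 3.6; [Kato2004Asterisque] Thm. 17.4; [Cremona2006] Table 1.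
-/

set_option autoImplicit false
set_option linter.dupNamespace false

noncomputable section

open scoped Classical MatrixGroups ModularForm NumberField
open CongruenceSubgroup WeierstrassCurve NumberField IsDedekindDomain Field
  Literature.NumberTheory.EllipticCurves Literature.NumberTheory.EllipticCurves.ModularForms
  Literature.NumberTheory.EllipticCurves.GreenbergVatsal2000
  Literature.NumberTheory.EllipticCurves.Rank1Residual
  Literature.NumberTheory.EllipticCurves.Rank1Residual.Typed
  Literature.NumberTheory.EllipticCurves.Delbourgo2002
  Literature.NumberTheory.EllipticCurves.Disegni2017
  Literature.NumberTheory.EllipticCurves.Fisher2012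
  Literature.NumberTheory.GaloisRepresentations
  Summit.BirchSwinnertonDyer.Rank1Residual.AdditivePotMult
  Summit.BirchSwinnertonDyer.Rank1Residual.Additive
  Summit.BirchSwinnertonDyer.Rank1Residual.GaloisImage

namespace Summit.BirchSwinnertonDyer.BirchSwinnertonDyer.Theorems.AdditiveBranchIMCGordTwoRankOne

open Summit.BirchSwinnertonDyer.BirchSwinnertonDyer.Theorems.AdditiveBranchIMCGordTwoRankOneVisibility

/-! ### `205623g1` ← `159929a1` (direct pencil) -/

/-- **The `3`-congruence `159929a1[3] ≅ 205623g1[3]` PROVED IN THE KERNEL** (no named fact): `F = 159929a1 = [1, 1, 1, -111, 10]` is `ℚ`-isomorphic to the member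
`(λ : μ) = (-492 : 1)` of the DIRECT Hesse pencil `X_E(3)` (Fisher 2012 Thm. 13.2) of `E = 205623g1 = [0, 0, 1, -4269, -107357]` —
the two covariant identities `𝔠₄(λ,μ) = u⁴·c₄(F)`, `𝔠₆(λ,μ) = u⁶·c₆(F)` with `u = 108`
(`c₄(E) = 204912`, `c₆(E) = 92756232`, `c₄(F) = 5329`, `c₆(F) = -48761`) are checked by `norm_num` on the tree's closed forms
(`eval_hesseC4three` / `eval_hesseC6three` / `eval_hesseD3`) and fed to the PROVED transport
`Fisher2012.threeCongruent_of_hesseCertificate_unconditional`; certificate found by the seat's exact finder `find_hesse3.py`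
(rational roots of the degree-12 form `𝔠₄′(λ,1)³c₆(F)² − 𝔠₆′(λ,1)²c₄(F)³`, k1-c3 g8). Hypothesis: the target model `hWeq` only.
[cite: Fisher2012Hessian, Thm. 13.2 (n = 3)] [cite: Cremona2006, Table 1 (Cremona labels 205623g1, 159929a1)] -/
theorem threeCongruent_c205623g1_c159929a1 (W : WeierstrassCurve ℚ) [W.IsElliptic] (hWeq : W = ⟨0, 0, 1, -4269, -107357⟩) :
    ∃ θ : geomTorsion (⟨1, 1, 1, -111, 10⟩ : WeierstrassCurve ℚ) (3 : ℤ) ≃+ geomTorsion W (3 : ℤ),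
      ∀ (σ : Field.absoluteGaloisGroup ℚ) (P : geomTorsion (⟨1, 1, 1, -111, 10⟩ : WeierstrassCurve ℚ) (3 : ℤ)),
        θ (σ • P) = σ • θ P := by
  haveI := isElliptic_c159929a1
  have hc4 : W.c₄ = (204912 : ℚ) := by
    subst hWeq; norm_num [WeierstrassCurve.c₄, WeierstrassCurve.b₂, WeierstrassCurve.b₄]
  have hc6 : W.c₆ = (92756232 : ℚ) := by
    subst hWeq; norm_num [WeierstrassCurve.c₆, WeierstrassCurve.b₂, WeierstrassCurve.b₄, WeierstrassCurve.b₆]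
  have hc4F : (⟨1, 1, 1, -111, 10⟩ : WeierstrassCurve ℚ).c₄ = (5329 : ℚ) := by
    norm_num [WeierstrassCurve.c₄, WeierstrassCurve.b₂, WeierstrassCurve.b₄]
  have hc6F : (⟨1, 1, 1, -111, 10⟩ : WeierstrassCurve ℚ).c₆ = (-48761 : ℚ) := by
    norm_num [WeierstrassCurve.c₆, WeierstrassCurve.b₂, WeierstrassCurve.b₄, WeierstrassCurve.b₆]
  exact threeCongruent_of_hesseCertificate_unconditional W (⟨1, 1, 1, -111, 10⟩ : WeierstrassCurve ℚ)
    (-492 : ℚ) (1 : ℚ) (108 : ℚ) (by norm_num)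
    (by rw [hc4, hc6, hc4F, eval_hesseC4three]; norm_num) (by rw [hc4, hc6, hc6F, eval_hesseC6three]; norm_num)

/-- **`ord₃ #Ш(E)_an ≤ ord₃ #Ш(E)` for `E = 205623g1` (the crux's conclusion `MissingLowerBoundAt W 3` AT THE PAIR), `3`-congruence PROVED IN THE KERNEL.**
Binders: cite-only `hCT hGZK`; the model `hWeq`; Cremona's `r_an = 1` (`hr1`) and `#Ш(E)_an = q`, `ord₃ q ≤ 2` (`hq`/`hv`). Everything else —
the partner `F = 159929a1` (rank `2`), its minimal model, the two witnesses and their local `3`-divisibility, independence mod `3F(ℚ)`,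
`E[3]` irreducible, AND the `3`-congruence `F[3] ≅ E[3]` — is decided in the kernel (`missingLowerBoundAt_c205623g1_3_of_congr` +
`threeCongruent_c205623g1_c159929a1`). Per pair; NOT a class theorem; nothing booked. [cite: CremonaMazur2000, §3] [cite: AgasheStein2002, Lemma 3.6]
[cite: Fisher2012Hessian, Thm. 13.2 and §13 (n = 3)] [cite: Cremona2006, Table 1 (Cremona labels 205623g1, 159929a1)] -/
theorem missingLowerBoundAt_c205623g1_3
    (hCT : exists_casselsTate_pairing (K := ℚ)) (hGZK : rank_eq_analyticRank_of_analyticRank_le_one)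
    {W : WeierstrassCurve ℚ} [W.IsElliptic] [W.IsGloballyMinimal] (hWeq : W = ⟨0, 0, 1, -4269, -107357⟩)
    (hr1 : W.analyticRank = 1) {q : ℚ} (hq : shaAn W = (q : ℂ)) (hv : padicValRat 3 q ≤ 2) :
    MissingLowerBoundAt W 3 := by
  haveI := isElliptic_c159929a1
  haveI := isGloballyMinimal_c159929a1
  obtain ⟨θ, hθ⟩ := threeCongruent_c205623g1_c159929a1 W hWeq
  exact missingLowerBoundAt_c205623g1_3_of_congr (F := (⟨1, 1, 1, -111, 10⟩ : WeierstrassCurve ℚ)) hCT hGZK hWeq rfl hr1 hq hv θ hθ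

/-- **`BSD(E,3)` for `E = 205623g1` BY NAME, `3`-congruence PROVED IN THE KERNEL** — cite-only `hK hCT hCyc hArt h73 hWald hmod hmodD hmodN hGZK`;
the model `hWeq`; data-level flags `ClassX4Gord W 3`, `Surj W 3`, `r_an = 1` (the cell's census / Cremona); the two-engine weak certificate
`A′(E,3) ≠ 0` (`hne`); the EXACT datum `#Ш(E)_an = q`, `ord₃ q ≤ 2` (Cremona `#Ш_an = 9`). NO partner binder, NO `θ` (door
`bsdp_c205623g1_3_of_congr` + `threeCongruent_c205623g1_c159929a1`). UPPER half = Kato half + cyclotomic-line identity + Schneider from `A′ ≠ 0`;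
LOWER half = two-witness visibility from `F = 159929a1`. Per pair; NOT a class theorem; nothing booked.
[cite: Kato2004Asterisque, Thm. 17.4 (3) (p. 273)] [cite: CremonaMazur2000, §3] [cite: Fisher2012Hessian, Thm. 13.2 and §13 (n = 3)]
[cite: Miller2011LMS, Def. 1.1] [cite: Cremona2006, Table 1 (Cremona labels 205623g1, 159929a1)] -/
theorem bsdp_c205623g1_3
    (hK : Wuthrich2014.kato_halfEigenCharIdeal_dvd_cyclotomicPrime_of_surjective)
    (hCT : exists_casselsTate_pairing (K := ℚ)) (hCyc : delbourgoDatum_cycLineGrossZagier)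
    (hArt : rankinSelbergEulerProductHecke_baseChangeDirichlet_eq) (h73 : GrossZagier1986_thm_I_7_3)
    (hWald : waldspurger_exists_heegnerField_twist_ne_zero)
    (hmod : hasEntireLFunction_rat) (hmodD : nonempty_modularParametrizationData)
    (hmodN : exists_isNewformOf) (hGZK : rank_eq_analyticRank_of_analyticRank_le_one)
    {W : WeierstrassCurve ℚ} [W.IsElliptic] [W.IsGloballyMinimal] (hWeq : W = ⟨0, 0, 1, -4269, -107357⟩)
    (hX : ClassX4Gord W 3) (hsurj : Surj W 3) (hr1 : W.analyticRank = 1) (hne : BranchCoeffOneNeZeroAt W 3)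
    {q : ℚ} (hq : shaAn W = (q : ℂ)) (hv : padicValRat 3 q ≤ 2) : BSDp W 3 := by
  haveI := isElliptic_c159929a1
  haveI := isGloballyMinimal_c159929a1
  obtain ⟨θ, hθ⟩ := threeCongruent_c205623g1_c159929a1 W hWeq
  exact bsdp_c205623g1_3_of_congr (F := (⟨1, 1, 1, -111, 10⟩ : WeierstrassCurve ℚ)) hK hCT hCyc hArt h73 hWald hmod hmodD hmodN hGZK hWeq rfl
    hX hsurj hr1 hne hq hv θ hθ

/-! ### `355392y1` ← `355392a1` (direct pencil) -/

/-- **The `3`-congruence `355392a1[3] ≅ 355392y1[3]` PROVED IN THE KERNEL** (no named fact): `F = 355392a1 = [0, 0, 0, -1884, 23024]` is `ℚ`-isomorphic to the member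
`(λ : μ) = (-2808 : 1)` of the DIRECT Hesse pencil `X_E(3)` (Fisher 2012 Thm. 13.2) of `E = 355392y1 = [0, 0, 0, -259500, -50924752]` —
the two covariant identities `𝔠₄(λ,μ) = u⁴·c₄(F)`, `𝔠₆(λ,μ) = u⁶·c₆(F)` with `u = 3072`
(`c₄(E) = 12456000`, `c₆(E) = 43998985728`, `c₄(F) = 90432`, `c₆(F) = -19892736`) are checked by `norm_num` on the tree's closed forms
(`eval_hesseC4three` / `eval_hesseC6three` / `eval_hesseD3`) and fed to the PROVED transport
`Fisher2012.threeCongruent_of_hesseCertificate_unconditional`; certificate found by the seat's exact finder `find_hesse3.py`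
(rational roots of the degree-12 form `𝔠₄′(λ,1)³c₆(F)² − 𝔠₆′(λ,1)²c₄(F)³`, k1-c3 g8). Hypothesis: the target model `hWeq` only.
[cite: Fisher2012Hessian, Thm. 13.2 (n = 3)] [cite: Cremona2006, Table 1 (Cremona labels 355392y1, 355392a1)] -/
theorem threeCongruent_c355392y1_c355392a1 (W : WeierstrassCurve ℚ) [W.IsElliptic] (hWeq : W = ⟨0, 0, 0, -259500, -50924752⟩) :
    ∃ θ : geomTorsion (⟨0, 0, 0, -1884, 23024⟩ : WeierstrassCurve ℚ) (3 : ℤ) ≃+ geomTorsion W (3 : ℤ),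
      ∀ (σ : Field.absoluteGaloisGroup ℚ) (P : geomTorsion (⟨0, 0, 0, -1884, 23024⟩ : WeierstrassCurve ℚ) (3 : ℤ)),
        θ (σ • P) = σ • θ P := by
  haveI := isElliptic_c355392a1
  have hc4 : W.c₄ = (12456000 : ℚ) := by
    subst hWeq; norm_num [WeierstrassCurve.c₄, WeierstrassCurve.b₂, WeierstrassCurve.b₄]
  have hc6 : W.c₆ = (43998985728 : ℚ) := by
    subst hWeq; norm_num [WeierstrassCurve.c₆, WeierstrassCurve.b₂, WeierstrassCurve.b₄, WeierstrassCurve.b₆]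
  have hc4F : (⟨0, 0, 0, -1884, 23024⟩ : WeierstrassCurve ℚ).c₄ = (90432 : ℚ) := by
    norm_num [WeierstrassCurve.c₄, WeierstrassCurve.b₂, WeierstrassCurve.b₄]
  have hc6F : (⟨0, 0, 0, -1884, 23024⟩ : WeierstrassCurve ℚ).c₆ = (-19892736 : ℚ) := by
    norm_num [WeierstrassCurve.c₆, WeierstrassCurve.b₂, WeierstrassCurve.b₄, WeierstrassCurve.b₆]
  exact threeCongruent_of_hesseCertificate_unconditional W (⟨0, 0, 0, -1884, 23024⟩ : WeierstrassCurve ℚ)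
    (-2808 : ℚ) (1 : ℚ) (3072 : ℚ) (by norm_num)
    (by rw [hc4, hc6, hc4F, eval_hesseC4three]; norm_num) (by rw [hc4, hc6, hc6F, eval_hesseC6three]; norm_num)

/-- **`ord₃ #Ш(E)_an ≤ ord₃ #Ш(E)` for `E = 355392y1` (the crux's conclusion `MissingLowerBoundAt W 3` AT THE PAIR), `3`-congruence PROVED IN THE KERNEL.**
Binders: cite-only `hCT hGZK`; the model `hWeq`; Cremona's `r_an = 1` (`hr1`) and `#Ш(E)_an = q`, `ord₃ q ≤ 2` (`hq`/`hv`). Everything else —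
the partner `F = 355392a1` (rank `3`), its minimal model, the two witnesses and their local `3`-divisibility, independence mod `3F(ℚ)`,
`E[3]` irreducible, AND the `3`-congruence `F[3] ≅ E[3]` — is decided in the kernel (`missingLowerBoundAt_c355392y1_3_of_congr` +
`threeCongruent_c355392y1_c355392a1`). Per pair; NOT a class theorem; nothing booked. [cite: CremonaMazur2000, §3] [cite: AgasheStein2002, Lemma 3.6]
[cite: Fisher2012Hessian, Thm. 13.2 and §13 (n = 3)] [cite: Cremona2006, Table 1 (Cremona labels 355392y1, 355392a1)] -/
theorem missingLowerBoundAt_c355392y1_3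
    (hCT : exists_casselsTate_pairing (K := ℚ)) (hGZK : rank_eq_analyticRank_of_analyticRank_le_one)
    {W : WeierstrassCurve ℚ} [W.IsElliptic] [W.IsGloballyMinimal] (hWeq : W = ⟨0, 0, 0, -259500, -50924752⟩)
    (hr1 : W.analyticRank = 1) {q : ℚ} (hq : shaAn W = (q : ℂ)) (hv : padicValRat 3 q ≤ 2) :
    MissingLowerBoundAt W 3 := by
  haveI := isElliptic_c355392a1
  haveI := isGloballyMinimal_c355392a1
  obtain ⟨θ, hθ⟩ := threeCongruent_c355392y1_c355392a1 W hWeq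
  exact missingLowerBoundAt_c355392y1_3_of_congr (F := (⟨0, 0, 0, -1884, 23024⟩ : WeierstrassCurve ℚ)) hCT hGZK hWeq rfl hr1 hq hv θ hθ

/-- **`BSD(E,3)` for `E = 355392y1` BY NAME, `3`-congruence PROVED IN THE KERNEL** — cite-only `hK hCT hCyc hArt h73 hWald hmod hmodD hmodN hGZK`;
the model `hWeq`; data-level flags `ClassX4Gord W 3`, `Surj W 3`, `r_an = 1` (the cell's census / Cremona); the two-engine weak certificate
`A′(E,3) ≠ 0` (`hne`); the EXACT datum `#Ш(E)_an = q`, `ord₃ q ≤ 2` (Cremona `#Ш_an = 9`). NO partner binder, NO `θ` (door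
`bsdp_c355392y1_3_of_congr` + `threeCongruent_c355392y1_c355392a1`). UPPER half = Kato half + cyclotomic-line identity + Schneider from `A′ ≠ 0`;
LOWER half = two-witness visibility from `F = 355392a1`. Per pair; NOT a class theorem; nothing booked.
[cite: Kato2004Asterisque, Thm. 17.4 (3) (p. 273)] [cite: CremonaMazur2000, §3] [cite: Fisher2012Hessian, Thm. 13.2 and §13 (n = 3)]
[cite: Miller2011LMS, Def. 1.1] [cite: Cremona2006, Table 1 (Cremona labels 355392y1, 355392a1)] -/
theorem bsdp_c355392y1_3
    (hK : Wuthrich2014.kato_halfEigenCharIdeal_dvd_cyclotomicPrime_of_surjective)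
    (hCT : exists_casselsTate_pairing (K := ℚ)) (hCyc : delbourgoDatum_cycLineGrossZagier)
    (hArt : rankinSelbergEulerProductHecke_baseChangeDirichlet_eq) (h73 : GrossZagier1986_thm_I_7_3)
    (hWald : waldspurger_exists_heegnerField_twist_ne_zero)
    (hmod : hasEntireLFunction_rat) (hmodD : nonempty_modularParametrizationData)
    (hmodN : exists_isNewformOf) (hGZK : rank_eq_analyticRank_of_analyticRank_le_one)
    {W : WeierstrassCurve ℚ} [W.IsElliptic] [W.IsGloballyMinimal] (hWeq : W = ⟨0, 0, 0, -259500, -50924752⟩)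
    (hX : ClassX4Gord W 3) (hsurj : Surj W 3) (hr1 : W.analyticRank = 1) (hne : BranchCoeffOneNeZeroAt W 3)
    {q : ℚ} (hq : shaAn W = (q : ℂ)) (hv : padicValRat 3 q ≤ 2) : BSDp W 3 := by
  haveI := isElliptic_c355392a1
  haveI := isGloballyMinimal_c355392a1
  obtain ⟨θ, hθ⟩ := threeCongruent_c355392y1_c355392a1 W hWeq
  exact bsdp_c355392y1_3_of_congr (F := (⟨0, 0, 0, -1884, 23024⟩ : WeierstrassCurve ℚ)) hK hCT hCyc hArt h73 hWald hmod hmodD hmodN hGZK hWeq rfl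
    hX hsurj hr1 hne hq hv θ hθ

/-! ### `417024bc1` ← `46336j1` (direct pencil) -/

/-- **The `3`-congruence `46336j1[3] ≅ 417024bc1[3]` PROVED IN THE KERNEL** (no named fact): `F = 46336j1 = [0, -1, 0, -45, 181]` is `ℚ`-isomorphic to the member
`(λ : μ) = (-114936 : 7)` of the DIRECT Hesse pencil `X_E(3)` (Fisher 2012 Thm. 13.2) of `E = 417024bc1 = [0, 0, 0, -5616984, -5123926528]` —
the two covariant identities `𝔠₄(λ,μ) = u⁴·c₄(F)`, `𝔠₆(λ,μ) = u⁶·c₆(F)` with `u = 216`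
(`c₄(E) = 269615232`, `c₆(E) = 4427072520192`, `c₄(F) = 2176`, `c₆(F) = -143360`) are checked by `norm_num` on the tree's closed forms
(`eval_hesseC4three` / `eval_hesseC6three` / `eval_hesseD3`) and fed to the PROVED transport
`Fisher2012.threeCongruent_of_hesseCertificate_unconditional`; certificate found by the seat's exact finder `find_hesse3.py`
(rational roots of the degree-12 form `𝔠₄′(λ,1)³c₆(F)² − 𝔠₆′(λ,1)²c₄(F)³`, k1-c3 g8). Hypothesis: the target model `hWeq` only.
[cite: Fisher2012Hessian, Thm. 13.2 (n = 3)] [cite: Cremona2006, Table 1 (Cremona labels 417024bc1, 46336j1)] -/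
theorem threeCongruent_c417024bc1_c46336j1 (W : WeierstrassCurve ℚ) [W.IsElliptic] (hWeq : W = ⟨0, 0, 0, -5616984, -5123926528⟩) :
    ∃ θ : geomTorsion (⟨0, -1, 0, -45, 181⟩ : WeierstrassCurve ℚ) (3 : ℤ) ≃+ geomTorsion W (3 : ℤ),
      ∀ (σ : Field.absoluteGaloisGroup ℚ) (P : geomTorsion (⟨0, -1, 0, -45, 181⟩ : WeierstrassCurve ℚ) (3 : ℤ)),
        θ (σ • P) = σ • θ P := by
  haveI := isElliptic_c46336j1
  have hc4 : W.c₄ = (269615232 : ℚ) := by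
    subst hWeq; norm_num [WeierstrassCurve.c₄, WeierstrassCurve.b₂, WeierstrassCurve.b₄]
  have hc6 : W.c₆ = (4427072520192 : ℚ) := by
    subst hWeq; norm_num [WeierstrassCurve.c₆, WeierstrassCurve.b₂, WeierstrassCurve.b₄, WeierstrassCurve.b₆]
  have hc4F : (⟨0, -1, 0, -45, 181⟩ : WeierstrassCurve ℚ).c₄ = (2176 : ℚ) := by
    norm_num [WeierstrassCurve.c₄, WeierstrassCurve.b₂, WeierstrassCurve.b₄]
  have hc6F : (⟨0, -1, 0, -45, 181⟩ : WeierstrassCurve ℚ).c₆ = (-143360 : ℚ) := by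
    norm_num [WeierstrassCurve.c₆, WeierstrassCurve.b₂, WeierstrassCurve.b₄, WeierstrassCurve.b₆]
  exact threeCongruent_of_hesseCertificate_unconditional W (⟨0, -1, 0, -45, 181⟩ : WeierstrassCurve ℚ)
    (-114936 : ℚ) (7 : ℚ) (216 : ℚ) (by norm_num)
    (by rw [hc4, hc6, hc4F, eval_hesseC4three]; norm_num) (by rw [hc4, hc6, hc6F, eval_hesseC6three]; norm_num)

/-- **`ord₃ #Ш(E)_an ≤ ord₃ #Ш(E)` for `E = 417024bc1` (the crux's conclusion `MissingLowerBoundAt W 3` AT THE PAIR), `3`-congruence PROVED IN THE KERNEL.**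
Binders: cite-only `hCT hGZK`; the model `hWeq`; Cremona's `r_an = 1` (`hr1`) and `#Ш(E)_an = q`, `ord₃ q ≤ 2` (`hq`/`hv`). Everything else —
the partner `F = 46336j1` (rank `2`), its minimal model, the two witnesses and their local `3`-divisibility, independence mod `3F(ℚ)`,
`E[3]` irreducible, AND the `3`-congruence `F[3] ≅ E[3]` — is decided in the kernel (`missingLowerBoundAt_c417024bc1_3_of_congr` +
`threeCongruent_c417024bc1_c46336j1`). Per pair; NOT a class theorem; nothing booked. [cite: CremonaMazur2000, §3] [cite: AgasheStein2002, Lemma 3.6]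
[cite: Fisher2012Hessian, Thm. 13.2 and §13 (n = 3)] [cite: Cremona2006, Table 1 (Cremona labels 417024bc1, 46336j1)] -/
theorem missingLowerBoundAt_c417024bc1_3
    (hCT : exists_casselsTate_pairing (K := ℚ)) (hGZK : rank_eq_analyticRank_of_analyticRank_le_one)
    {W : WeierstrassCurve ℚ} [W.IsElliptic] [W.IsGloballyMinimal] (hWeq : W = ⟨0, 0, 0, -5616984, -5123926528⟩)
    (hr1 : W.analyticRank = 1) {q : ℚ} (hq : shaAn W = (q : ℂ)) (hv : padicValRat 3 q ≤ 2) :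
    MissingLowerBoundAt W 3 := by
  haveI := isElliptic_c46336j1
  haveI := isGloballyMinimal_c46336j1
  obtain ⟨θ, hθ⟩ := threeCongruent_c417024bc1_c46336j1 W hWeq
  exact missingLowerBoundAt_c417024bc1_3_of_congr (F := (⟨0, -1, 0, -45, 181⟩ : WeierstrassCurve ℚ)) hCT hGZK hWeq rfl hr1 hq hv θ hθ

/-- **`BSD(E,3)` for `E = 417024bc1` BY NAME, `3`-congruence PROVED IN THE KERNEL** — cite-only `hK hCT hCyc hArt h73 hWald hmod hmodD hmodN hGZK`;
the model `hWeq`; data-level flags `ClassX4Gord W 3`, `Surj W 3`, `r_an = 1` (the cell's census / Cremona); the two-engine weak certificate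
`A′(E,3) ≠ 0` (`hne`); the EXACT datum `#Ш(E)_an = q`, `ord₃ q ≤ 2` (Cremona `#Ш_an = 9`). NO partner binder, NO `θ` (door
`bsdp_c417024bc1_3_of_congr` + `threeCongruent_c417024bc1_c46336j1`). UPPER half = Kato half + cyclotomic-line identity + Schneider from `A′ ≠ 0`;
LOWER half = two-witness visibility from `F = 46336j1`. Per pair; NOT a class theorem; nothing booked.
[cite: Kato2004Asterisque, Thm. 17.4 (3) (p. 273)] [cite: CremonaMazur2000, §3] [cite: Fisher2012Hessian, Thm. 13.2 and §13 (n = 3)]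
[cite: Miller2011LMS, Def. 1.1] [cite: Cremona2006, Table 1 (Cremona labels 417024bc1, 46336j1)] -/
theorem bsdp_c417024bc1_3
    (hK : Wuthrich2014.kato_halfEigenCharIdeal_dvd_cyclotomicPrime_of_surjective)
    (hCT : exists_casselsTate_pairing (K := ℚ)) (hCyc : delbourgoDatum_cycLineGrossZagier)
    (hArt : rankinSelbergEulerProductHecke_baseChangeDirichlet_eq) (h73 : GrossZagier1986_thm_I_7_3)
    (hWald : waldspurger_exists_heegnerField_twist_ne_zero)
    (hmod : hasEntireLFunction_rat) (hmodD : nonempty_modularParametrizationData)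
    (hmodN : exists_isNewformOf) (hGZK : rank_eq_analyticRank_of_analyticRank_le_one)
    {W : WeierstrassCurve ℚ} [W.IsElliptic] [W.IsGloballyMinimal] (hWeq : W = ⟨0, 0, 0, -5616984, -5123926528⟩)
    (hX : ClassX4Gord W 3) (hsurj : Surj W 3) (hr1 : W.analyticRank = 1) (hne : BranchCoeffOneNeZeroAt W 3)
    {q : ℚ} (hq : shaAn W = (q : ℂ)) (hv : padicValRat 3 q ≤ 2) : BSDp W 3 := by
  haveI := isElliptic_c46336j1
  haveI := isGloballyMinimal_c46336j1
  obtain ⟨θ, hθ⟩ := threeCongruent_c417024bc1_c46336j1 W hWeq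
  exact bsdp_c417024bc1_3_of_congr (F := (⟨0, -1, 0, -45, 181⟩ : WeierstrassCurve ℚ)) hK hCT hCyc hArt h73 hWald hmod hmodD hmodN hGZK hWeq rfl
    hX hsurj hr1 hne hq hv θ hθ

/-! ### `449352f1` ← `449352b1` (dual pencil) -/

/-- **The `3`-congruence `449352b1[3] ≅ 449352f1[3]` PROVED IN THE KERNEL** (no named fact): `F = 449352b1 = [0, 0, 0, -6636, 208244]` is `ℚ`-isomorphic to the member
`(λ : μ) = (6636 : 1)` of the DUAL Hesse pencil `X_E⁻(3)` (Fisher 2012 §13) of `E = 449352f1 = [0, 0, 0, -917427, 284976542]` —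
the two covariant identities `−𝔇(λ,μ)/(4Δ′) = u⁴·c₄(F)`, `−𝔠₆(λ,μ)/(8Δ′²) = u⁶·c₆(F)` (`Δ′ = c₄(E)³ − c₆(E)²`) with `u = 1/1896`
(`c₄(E) = 44036496`, `c₆(E) = -246219732288`, `c₄(F) = 318528`, `c₆(F) = -179922816`) are checked by `norm_num` on the tree's closed forms
(`eval_hesseC4three` / `eval_hesseC6three` / `eval_hesseD3`) and fed to the PROVED transport
`Fisher2012.threeCongruent_of_dualHesseCertificate_unconditional`; certificate found by the seat's exact finder `find_hesse3.py`
(rational roots of the degree-12 form `𝔠₄′(λ,1)³c₆(F)² − 𝔠₆′(λ,1)²c₄(F)³`, k1-c3 g8). Hypothesis: the target model `hWeq` only.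
[cite: Fisher2012Hessian, §13 (analogue of Thm. 13.2 for X_E^-(3))] [cite: Cremona2006, Table 1 (Cremona labels 449352f1, 449352b1)] -/
theorem threeCongruent_c449352f1_c449352b1 (W : WeierstrassCurve ℚ) [W.IsElliptic] (hWeq : W = ⟨0, 0, 0, -917427, 284976542⟩) :
    ∃ θ : geomTorsion (⟨0, 0, 0, -6636, 208244⟩ : WeierstrassCurve ℚ) (3 : ℤ) ≃+ geomTorsion W (3 : ℤ),
      ∀ (σ : Field.absoluteGaloisGroup ℚ) (P : geomTorsion (⟨0, 0, 0, -6636, 208244⟩ : WeierstrassCurve ℚ) (3 : ℤ)),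
        θ (σ • P) = σ • θ P := by
  haveI := isElliptic_c449352b1
  have hc4 : W.c₄ = (44036496 : ℚ) := by
    subst hWeq; norm_num [WeierstrassCurve.c₄, WeierstrassCurve.b₂, WeierstrassCurve.b₄]
  have hc6 : W.c₆ = (-246219732288 : ℚ) := by
    subst hWeq; norm_num [WeierstrassCurve.c₆, WeierstrassCurve.b₂, WeierstrassCurve.b₄, WeierstrassCurve.b₆]
  have hc4F : (⟨0, 0, 0, -6636, 208244⟩ : WeierstrassCurve ℚ).c₄ = (318528 : ℚ) := by
    norm_num [WeierstrassCurve.c₄, WeierstrassCurve.b₂, WeierstrassCurve.b₄]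
  have hc6F : (⟨0, 0, 0, -6636, 208244⟩ : WeierstrassCurve ℚ).c₆ = (-179922816 : ℚ) := by
    norm_num [WeierstrassCurve.c₆, WeierstrassCurve.b₂, WeierstrassCurve.b₄, WeierstrassCurve.b₆]
  exact threeCongruent_of_dualHesseCertificate_unconditional W (⟨0, 0, 0, -6636, 208244⟩ : WeierstrassCurve ℚ)
    (6636 : ℚ) (1 : ℚ) ((1 : ℚ) / 1896) (by norm_num)
    (by rw [hc4, hc6, hc4F, eval_hesseD3]; norm_num) (by rw [hc4, hc6, hc6F, eval_hesseC6three]; norm_num)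

/-- **`ord₃ #Ш(E)_an ≤ ord₃ #Ш(E)` for `E = 449352f1` (the crux's conclusion `MissingLowerBoundAt W 3` AT THE PAIR), `3`-congruence PROVED IN THE KERNEL.**
Binders: cite-only `hCT hGZK`; the model `hWeq`; Cremona's `r_an = 1` (`hr1`) and `#Ш(E)_an = q`, `ord₃ q ≤ 2` (`hq`/`hv`). Everything else —
the partner `F = 449352b1` (rank `3`), its minimal model, the two witnesses and their local `3`-divisibility, independence mod `3F(ℚ)`,
`E[3]` irreducible, AND the `3`-congruence `F[3] ≅ E[3]` — is decided in the kernel (`missingLowerBoundAt_c449352f1_3_of_congr` +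
`threeCongruent_c449352f1_c449352b1`). Per pair; NOT a class theorem; nothing booked. [cite: CremonaMazur2000, §3] [cite: AgasheStein2002, Lemma 3.6]
[cite: Fisher2012Hessian, Thm. 13.2 and §13 (n = 3)] [cite: Cremona2006, Table 1 (Cremona labels 449352f1, 449352b1)] -/
theorem missingLowerBoundAt_c449352f1_3
    (hCT : exists_casselsTate_pairing (K := ℚ)) (hGZK : rank_eq_analyticRank_of_analyticRank_le_one)
    {W : WeierstrassCurve ℚ} [W.IsElliptic] [W.IsGloballyMinimal] (hWeq : W = ⟨0, 0, 0, -917427, 284976542⟩)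
    (hr1 : W.analyticRank = 1) {q : ℚ} (hq : shaAn W = (q : ℂ)) (hv : padicValRat 3 q ≤ 2) :
    MissingLowerBoundAt W 3 := by
  haveI := isElliptic_c449352b1
  haveI := isGloballyMinimal_c449352b1
  obtain ⟨θ, hθ⟩ := threeCongruent_c449352f1_c449352b1 W hWeq
  exact missingLowerBoundAt_c449352f1_3_of_congr (F := (⟨0, 0, 0, -6636, 208244⟩ : WeierstrassCurve ℚ)) hCT hGZK hWeq rfl hr1 hq hv θ hθ

/-- **`BSD(E,3)` for `E = 449352f1` BY NAME, `3`-congruence PROVED IN THE KERNEL** — cite-only `hK hCT hCyc hArt h73 hWald hmod hmodD hmodN hGZK`;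
the model `hWeq`; data-level flags `ClassX4Gord W 3`, `Surj W 3`, `r_an = 1` (the cell's census / Cremona); the two-engine weak certificate
`A′(E,3) ≠ 0` (`hne`); the EXACT datum `#Ш(E)_an = q`, `ord₃ q ≤ 2` (Cremona `#Ш_an = 9`). NO partner binder, NO `θ` (door
`bsdp_c449352f1_3_of_congr` + `threeCongruent_c449352f1_c449352b1`). UPPER half = Kato half + cyclotomic-line identity + Schneider from `A′ ≠ 0`;
LOWER half = two-witness visibility from `F = 449352b1`. Per pair; NOT a class theorem; nothing booked.
[cite: Kato2004Asterisque, Thm. 17.4 (3) (p. 273)] [cite: CremonaMazur2000, §3] [cite: Fisher2012Hessian, Thm. 13.2 and §13 (n = 3)]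
[cite: Miller2011LMS, Def. 1.1] [cite: Cremona2006, Table 1 (Cremona labels 449352f1, 449352b1)] -/
theorem bsdp_c449352f1_3
    (hK : Wuthrich2014.kato_halfEigenCharIdeal_dvd_cyclotomicPrime_of_surjective)
    (hCT : exists_casselsTate_pairing (K := ℚ)) (hCyc : delbourgoDatum_cycLineGrossZagier)
    (hArt : rankinSelbergEulerProductHecke_baseChangeDirichlet_eq) (h73 : GrossZagier1986_thm_I_7_3)
    (hWald : waldspurger_exists_heegnerField_twist_ne_zero)
    (hmod : hasEntireLFunction_rat) (hmodD : nonempty_modularParametrizationData)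
    (hmodN : exists_isNewformOf) (hGZK : rank_eq_analyticRank_of_analyticRank_le_one)
    {W : WeierstrassCurve ℚ} [W.IsElliptic] [W.IsGloballyMinimal] (hWeq : W = ⟨0, 0, 0, -917427, 284976542⟩)
    (hX : ClassX4Gord W 3) (hsurj : Surj W 3) (hr1 : W.analyticRank = 1) (hne : BranchCoeffOneNeZeroAt W 3)
    {q : ℚ} (hq : shaAn W = (q : ℂ)) (hv : padicValRat 3 q ≤ 2) : BSDp W 3 := by
  haveI := isElliptic_c449352b1
  haveI := isGloballyMinimal_c449352b1
  obtain ⟨θ, hθ⟩ := threeCongruent_c449352f1_c449352b1 W hWeq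
  exact bsdp_c449352f1_3_of_congr (F := (⟨0, 0, 0, -6636, 208244⟩ : WeierstrassCurve ℚ)) hK hCT hCyc hArt h73 hWald hmod hmodD hmodN hGZK hWeq rfl
    hX hsurj hr1 hne hq hv θ hθ

end Summit.BirchSwinnertonDyer.BirchSwinnertonDyer.Theorems.AdditiveBranchIMCGordTwoRankOne

end
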